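import Mathlib

/-!
# Per-position ratio `5/8` of the far-rider endgame (scalar core)

Crux `Summit.MatrixMultiplication.MatrixMultiplication.Theses.SnSubsetDichotomy.PolynomialSlack`
(item `stmt-MatrixMultiplication-8306`), level-one programme, line transport-split-hull (lead c10).

The pure real inequality behind `position_kept_bound_far`.  At a hub position the INCLUDED T-levels
are sorted into three classes by their cost rate `u = 1 - log x / log n`: cheap `C` (`u < 0.475`),
mid `M` (`0.475 ≤ u ≤ 0.515`) and dear `H` (`u > 0.515`), with class masses `XC, XM, XH` and class
costs `xC ∈ [0.245 XC, 0.475 XC]`, `xM ∈ [0.475 XM, 0.515 XM]`, `xH ∈ [0.515 XH, 0.755 XH]`; the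
S-levels likewise (`Y`, `y`).  Productive pairs have `u + v ≥ 0.99`, so a cheap level is productive
only with dear partners and a mid level only with mid or dear partners; far riders (`u + v < 0.76`)
never involve a dear level and never two mid levels, whence the three budgets
`XH + Y ≤ 1 + δ`, `X + YH ≤ 1 + δ`, `XM + XH + YM + YH ≤ 1 + δ` (`δ` the penalised overlap).
Charging each productive pair `σρ ≤ σρ (u+v)/0.99` gives the productive kept mass
`E ≤ (100/99)·K₁`, `K₁ = xH·Y + xM·(YM+YH) + xC·YH + yH·X + yM·(XM+XH) + yC·XH`, and the theorem
is `K₁ ≤ (99/100)(5/8)·(x + y) + δ (X + Y)`.  Numerically the supremum of `K₁/(x+y)` at `δ = 0`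
is `≈ 0.596` (lead c10, compute/fixed_lambda.py), attained near
`X = (0.19, 0.18, 0.33), Y = (0.18, 0.19, 0.30)` with all three budgets tight.

Proof.  By homogeneity it suffices to bound the left side by `κ s · (xC + ⋯ + yH)` with
`κ = 99/160 = (99/100)(5/8)` and `s = 1 + δ`: indeed every cost is at most `0.755` times its
mass, so `κ δ (xC + ⋯ + yH) ≤ δ (XC + ⋯ + YH)`.  The homogeneous bound
`κ s (xC + ⋯ + yH) - K₁ ≥ 0` is a quadratic polynomial inequality in the thirteen variables on the
polyhedron cut out by the sign, budget and box constraints; after splitting on the signs of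
`Y - κ s` and `X - κ s` (`X = XC + XM + XH`, `Y = YC + YM + YH`, the coefficients of `xH` and
`yH`) each of the four pieces is closed by `linarith` from an explicit degree-two
Positivstellensatz certificate: a nonnegative combination of pairwise products of the linear
constraints and of a few squares (found by exact rational linear programming; `linarith` only
has to recover the coefficients).
-/

namespace Summit.MatrixMultiplication.MatrixMultiplication.Theorems.PolynomialSlack

set_option linter.dupNamespace false

/-- **Per-position ratio `5/8` (far-rider endgame, scalar core).**  For non-negative class masses
`XC XM XH YC YM YH`, a relaxation `δ ≥ 0`, the three budgets and class costs in their rate boxes,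
`xH (YC+YM+YH) + xM (YM+YH) + xC YH + yH (XC+XM+XH) + yM (XM+XH) + yC XH
  ≤ (99/100)(5/8)(xC+xM+xH+yC+yM+yH) + δ (XC+XM+XH+YC+YM+YH)`. -/
theorem position_ratio_far (XC XM XH YC YM YH xC xM xH yC yM yH δ : ℝ)
    (hXC : 0 ≤ XC) (hXM : 0 ≤ XM) (hXH : 0 ≤ XH) (hYC : 0 ≤ YC) (hYM : 0 ≤ YM) (hYH : 0 ≤ YH)
    (hδ : 0 ≤ δ)
    (hB1 : XH + (YC + YM + YH) ≤ 1 + δ) (hB2 : (XC + XM + XH) + YH ≤ 1 + δ)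
    (hB3 : XM + XH + YM + YH ≤ 1 + δ)
    (hxC : 245 / 1000 * XC ≤ xC ∧ xC ≤ 475 / 1000 * XC)
    (hxM : 475 / 1000 * XM ≤ xM ∧ xM ≤ 515 / 1000 * XM)
    (hxH : 515 / 1000 * XH ≤ xH ∧ xH ≤ 755 / 1000 * XH)
    (hyC : 245 / 1000 * YC ≤ yC ∧ yC ≤ 475 / 1000 * YC)
    (hyM : 475 / 1000 * YM ≤ yM ∧ yM ≤ 515 / 1000 * YM)
    (hyH : 515 / 1000 * YH ≤ yH ∧ yH ≤ 755 / 1000 * YH) :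
    xH * (YC + YM + YH) + xM * (YM + YH) + xC * YH + yH * (XC + XM + XH) + yM * (XM + XH) + yC * XH
      ≤ 99 / 100 * (5 / 8) * (xC + xM + xH + yC + yM + yH) + δ * (XC + XM + XH + YC + YM + YH) := by
  -- the signed linear forms entering the certificates
  have b1 : 0 ≤ 1 + δ - XH - (YC + YM + YH) := by linarith
  have b2 : 0 ≤ 1 + δ - (XC + XM + XH) - YH := by linarith
  have b3 : 0 ≤ 1 + δ - (XM + XH + YM + YH) := by linarith
  have l1 : 0 ≤ xC - 245 / 1000 * XC := sub_nonneg.2 hxC.1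
  have u1 : 0 ≤ 475 / 1000 * XC - xC := sub_nonneg.2 hxC.2
  have l2 : 0 ≤ xM - 475 / 1000 * XM := sub_nonneg.2 hxM.1
  have u2 : 0 ≤ 515 / 1000 * XM - xM := sub_nonneg.2 hxM.2
  have l3 : 0 ≤ xH - 515 / 1000 * XH := sub_nonneg.2 hxH.1
  have u3 : 0 ≤ 755 / 1000 * XH - xH := sub_nonneg.2 hxH.2
  have l4 : 0 ≤ yC - 245 / 1000 * YC := sub_nonneg.2 hyC.1
  have u4 : 0 ≤ 475 / 1000 * YC - yC := sub_nonneg.2 hyC.2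
  have l5 : 0 ≤ yM - 475 / 1000 * YM := sub_nonneg.2 hyM.1
  have u5 : 0 ≤ 515 / 1000 * YM - yM := sub_nonneg.2 hyM.2
  have l6 : 0 ≤ yH - 515 / 1000 * YH := sub_nonneg.2 hyH.1
  have u6 : 0 ≤ 755 / 1000 * YH - yH := sub_nonneg.2 hyH.2
  -- the homogeneous bound `K₁ ≤ κ s (xC + ⋯ + yH)`
  have key : xH * (YC + YM + YH) + xM * (YM + YH) + xC * YH + yH * (XC + XM + XH)
      + yM * (XM + XH) + yC * XH ≤ 99 / 160 * (1 + δ) * (xC + xM + xH + yC + yM + yH) := by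
    rcases le_total (YC + YM + YH) (99 / 160 * (1 + δ)) with hY | hY <;>
    rcases le_total (XC + XM + XH) (99 / 160 * (1 + δ)) with hX | hX
    · -- `Y ≤ κ s`, `X ≤ κ s`: every coefficient is at most `κ s`, all six terms are nonpositive
      have hY : 0 ≤ 99 / 160 * (1 + δ) - (YC + YM + YH) := sub_nonneg.2 hY
      have hX : 0 ≤ 99 / 160 * (1 + δ) - (XC + XM + XH) := sub_nonneg.2 hX
      linarith [mul_nonneg hXC hYC, mul_nonneg hXC hYM, mul_nonneg hXC l4, mul_nonneg hXC l5,
        mul_nonneg hXC hY, mul_nonneg hXM hYC, mul_nonneg hXM l4, mul_nonneg hXM hY,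
        mul_nonneg hXH hY, mul_nonneg hYC l1, mul_nonneg hYC l2, mul_nonneg hYC hX,
        mul_nonneg hYM l1, mul_nonneg hYM hX, mul_nonneg hYH hX, mul_nonneg l1 hY,
        mul_nonneg l2 hY, mul_nonneg l3 hY, mul_nonneg l4 hX, mul_nonneg l5 hX, mul_nonneg l6 hX]
    · -- `Y ≤ κ s ≤ X`
      have hY : 0 ≤ 99 / 160 * (1 + δ) - (YC + YM + YH) := sub_nonneg.2 hY
      have hX : 0 ≤ XC + XM + XH - 99 / 160 * (1 + δ) := sub_nonneg.2 hX
      linarith [mul_nonneg hXC hYM, mul_nonneg hXC b2, mul_nonneg hXC l4, mul_nonneg hXC l5,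
        mul_nonneg hXM hYC, mul_nonneg hXM b3, mul_nonneg hXM l4, mul_nonneg hXH b1,
        mul_nonneg hXH b3, mul_nonneg hXH hY, mul_nonneg hYC hYC, mul_nonneg hYC b1,
        mul_nonneg hYC b2, mul_nonneg hYC l1, mul_nonneg hYC l2, mul_nonneg hYC hX,
        mul_nonneg hYM hYH, mul_nonneg hYM b1, mul_nonneg hYM b3, mul_nonneg hYM l1,
        mul_nonneg hYH b2, mul_nonneg b2 hX, mul_nonneg l1 hY, mul_nonneg l2 hY, mul_nonneg l3 hY,
        mul_nonneg u4 hX, mul_nonneg u5 hX, mul_nonneg u6 hX, mul_nonneg hY hX, mul_nonneg hX hX,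
        sq_nonneg (XC - 2 * YC), sq_nonneg (XC - 2 * YH),
        sq_nonneg (XC - 2 * (99 / 160 * (1 + δ) - (YC + YM + YH))),
        sq_nonneg (XC - 2 * (XC + XM + XH - 99 / 160 * (1 + δ))), sq_nonneg (XM - YM),
        sq_nonneg (XM - 2 * YM), sq_nonneg (XM - YH),
        sq_nonneg (XM - (99 / 160 * (1 + δ) - (YC + YM + YH))), sq_nonneg (XM - (YM + YH))]
    · -- `X ≤ κ s ≤ Y`
      have hY : 0 ≤ YC + YM + YH - 99 / 160 * (1 + δ) := sub_nonneg.2 hY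
      have hX : 0 ≤ 99 / 160 * (1 + δ) - (XC + XM + XH) := sub_nonneg.2 hX
      linarith [mul_nonneg hXC hXH, mul_nonneg hXC hYM, mul_nonneg hXC b2, mul_nonneg hXC l5,
        mul_nonneg hXM hYC, mul_nonneg hXM b2, mul_nonneg hXM b3, mul_nonneg hXH b1,
        mul_nonneg hXH b3, mul_nonneg hXH l1, mul_nonneg hYC l1, mul_nonneg hYC l2,
        mul_nonneg hYC l4, mul_nonneg hYM b3, mul_nonneg hYM l1, mul_nonneg hYM l4,
        mul_nonneg hYM hY, mul_nonneg hYM hX, mul_nonneg hYH b2, mul_nonneg hYH l4,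
        mul_nonneg b1 b2, mul_nonneg b1 l1, mul_nonneg b1 l4, mul_nonneg b1 hY, mul_nonneg b1 hX,
        mul_nonneg b2 l1, mul_nonneg u1 hY, mul_nonneg u1 hX, mul_nonneg u2 hY, mul_nonneg u3 hY,
        mul_nonneg l4 hY, mul_nonneg l5 hX, mul_nonneg l6 hX, mul_nonneg hY hY,
        sq_nonneg (XC - YH), sq_nonneg (XC - 1 / 2 * YH),
        sq_nonneg (XC - 2 * (YC + YM + YH - 99 / 160 * (1 + δ))), sq_nonneg (XM - 2 * YM),
        sq_nonneg (XM - 2 * (YC + YM + YH - 99 / 160 * (1 + δ))),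
        sq_nonneg (XM - (99 / 160 * (1 + δ) - (XC + XM + XH))),
        sq_nonneg (XM - 2 * (99 / 160 * (1 + δ) - (XC + XM + XH))),
        sq_nonneg (XM - 1 / 2 * (YM + YH)), sq_nonneg (XH - 1 / 2 * YC),
        sq_nonneg (XH - 1 / 2 * YM), sq_nonneg (XH - YH)]
    · -- `κ s ≤ X`, `κ s ≤ Y`
      have hY : 0 ≤ YC + YM + YH - 99 / 160 * (1 + δ) := sub_nonneg.2 hY
      have hX : 0 ≤ XC + XM + XH - 99 / 160 * (1 + δ) := sub_nonneg.2 hX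
      linarith [mul_nonneg hXC b2, mul_nonneg hXC u2, mul_nonneg hXC l5, mul_nonneg hXC hY,
        mul_nonneg hXM b3, mul_nonneg hXM hX, mul_nonneg hXH b1, mul_nonneg hXH l1,
        mul_nonneg hXH l2, mul_nonneg hYC b2, mul_nonneg hYC l1, mul_nonneg hYC l2,
        mul_nonneg hYC l4, mul_nonneg hYC u5, mul_nonneg hYM b1, mul_nonneg hYM b3,
        mul_nonneg hYM l1, mul_nonneg hYM l4, mul_nonneg hYM hY, mul_nonneg hYH b2,
        mul_nonneg hYH l4, mul_nonneg hYH l5, mul_nonneg b1 b2, mul_nonneg b1 l1, mul_nonneg b1 l2,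
        mul_nonneg b1 l4, mul_nonneg b1 hY, mul_nonneg b1 hX, mul_nonneg b2 l1, mul_nonneg b2 l5,
        mul_nonneg b2 hY, mul_nonneg b2 hX, mul_nonneg b3 l2, mul_nonneg b3 l5, mul_nonneg b3 hX,
        mul_nonneg l1 hX, mul_nonneg l2 hX, mul_nonneg u3 hY, mul_nonneg l4 hY, mul_nonneg l5 hY,
        mul_nonneg u6 hX, mul_nonneg hY hY, mul_nonneg hY hX, mul_nonneg hX hX,
        sq_nonneg (XC - XH), sq_nonneg (XC - 2 * XH), sq_nonneg (XC - YC), sq_nonneg (XC - YH),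
        sq_nonneg (XC - 2 * (XC + XM + XH - 99 / 160 * (1 + δ))), sq_nonneg (XC - (YM + YH)),
        sq_nonneg (XM - XH), sq_nonneg (XM - YM), sq_nonneg (XM - 2 * YM)]
  -- back to `δ`: `κ δ (xC + ⋯ + yH) ≤ δ (XC + ⋯ + YH)` since every rate is at most `0.755`
  have hz : 99 / 160 * (xC + xM + xH + yC + yM + yH) ≤ XC + XM + XH + YC + YM + YH := by
    linarith
  have hδz := mul_le_mul_of_nonneg_left hz hδ
  linarith

end Summit.MatrixMultiplication.MatrixMultiplication.Theorems.PolynomialSlack
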